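import Mathlib.Analysis.InnerProductSpace.Calculus
import Mathlib.Analysis.InnerProductSpace.PiL2
import Mathlib.Analysis.Normed.Algebra.Exponential
import Mathlib.Analysis.SpecialFunctions.Exponential
import Mathlib.Analysis.Calculus.FDeriv.Pi
import Mathlib.Analysis.Calculus.Deriv.Comp
import Mathlib.Analysis.Calculus.Deriv.Mul
import Mathlib.Analysis.Calculus.Deriv.Prod
import Literature.Analysis.FluidPDE.TypeIAncientMildRssPullback
import HarnessLib

/-!
# Infinitesimal rotation invariance: the derivative along a rotation generator vanishes

Stub `Z3` of line Sketch (skeleton v16) for the crux `MoebiusLimitExists` of route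
`PlantedPinning` (`Summit.CriticalPhenomena.Ising3DConformalLimit`). For a level
`F : (ℝ³)ⁿ → ℝ` that is invariant under the diagonal action `y ↦ (R yᵢ)ᵢ` of every linear
isometric isomorphism `R` of `ℝ³` and is differentiable at `x`, the derivative of `F` at `x` along
every rotation generator vanishes:
`DF(x)[(⟪c, xᵢ⟫ b − ⟪b, xᵢ⟫ c)ᵢ] = 0` for all `b c : ℝ³` (`stub_fderiv_rotationGenerator`).

Proof: the generator `A v := ⟪c, v⟫ b − ⟪b, v⟫ c` is skew (`⟪A v, v⟫ = 0`), so each `e^{tA}`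
(`NormedSpace.exp (t • A)` in the Banach algebra `E →L[ℝ] E`) is (the map of) a linear isometric
isomorphism — this is `Literature.Analysis.FluidPDE.rss_exists_rot`, reused. Hence
`t ↦ F ((e^{tA} xᵢ)ᵢ)` is constant, while by the chain rule its derivative at `t = 0` is
`DF(x)[(A xᵢ)ᵢ]`; derivatives are unique.

## References

Standard (E. Noether 1918 / S. Lie: invariance under a one-parameter group kills the derivative
along its generator; here for the rotation group `SO(3)` acting diagonally). [folklore]

## Design choices

* The isometries `e^{tA}` come from `Literature/Analysis/FluidPDE/TypeIAncientMildRssPullback.lean`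
  (`rss_exists_rot`: for skew `B`, `e^{-ρB}` is a linear isometric isomorphism with inverse
  `e^{ρB}`); nothing of that toolkit is re-proved. No new definitions: the generator is the
  bounded operator `(innerSL ℝ c).smulRight b - (innerSL ℝ b).smulRight c`, kept inline.
* All operator algebra is done for a general real inner product space `E` and only instantiated
  at `EuclideanSpace ℝ (Fin 3)` by `exact` (on `PiLp` the scalar action on `E →L[ℝ] E` is found
  along two instance paths that agree only up to unfolding, which defeats `rw`/`simp` there).
* NOT here: the other symmetries of the special-conformal defect (permutations, translations,
  dilations) or the jet door — those are separate files of the same skeleton.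
-/

noncomputable section

open scoped RealInnerProductSpace

namespace Summit.CriticalPhenomena.Ising3DConformalLimit.MoebiusLimitExistsSketchV16

variable {E : Type*} [NormedAddCommGroup E] [InnerProductSpace ℝ E]

/-- At `t = 0` the one-parameter group generated by a bounded operator `B` is the identity:
`e^{0·B} y = y`. [folklore] -/
theorem exp_zero_smul_clm_apply (B : E →L[ℝ] E) (y : E) :
    NormedSpace.exp ((0 : ℝ) • B) y = y := by
  rw [zero_smul, NormedSpace.exp_zero, one_apply_eq_self]

/-- At `t = 0` the velocity of the one-parameter group generated by a bounded operator `B` is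
`B` itself: `d/dt|_{t=0} (e^{tB} y) = B y`. [folklore] -/
theorem hasDerivAt_exp_smul_clm_apply_zero [CompleteSpace E] (B : E →L[ℝ] E) (y : E) :
    HasDerivAt (fun s : ℝ => NormedSpace.exp (s • B) y) (B y) 0 := by
  simpa using (hasDerivAt_exp_smul_const' (𝕂 := ℝ) B (0 : ℝ)).clm_apply
    (hasDerivAt_const (0 : ℝ) y)

/-- For a bounded skew operator `B` (`⟪B y, y⟫ = 0` for all `y`) on a real Hilbert space and every
`t : ℝ`, the operator `e^{tB}` is (the underlying map of) a linear isometric isomorphism of the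
space (`Literature.Analysis.FluidPDE.rss_exists_rot`, read through the inverse). [folklore] -/
theorem exists_linearIsometryEquiv_eq_exp_smul [CompleteSpace E] {B : E →L[ℝ] E}
    (hB : ∀ y, ⟪B y, y⟫ = 0) (t : ℝ) :
    ∃ L : E ≃ₗᵢ[ℝ] E, ∀ y, L y = NormedSpace.exp (t • B) y := by
  obtain ⟨L, -, hL⟩ := Literature.Analysis.FluidPDE.rss_exists_rot hB t
  exact ⟨L.symm, hL⟩

/-- The rotation generator `v ↦ ⟪c, v⟫ b − ⟪b, v⟫ c` of a real inner product space, written as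
the bounded operator `(innerSL ℝ c).smulRight b − (innerSL ℝ b).smulRight c`, acts by
`v ↦ ⟪c, v⟫ • b − ⟪b, v⟫ • c`. [folklore] -/
theorem rotationGenerator_apply (b c v : E) :
    ((innerSL ℝ c).smulRight b - (innerSL ℝ b).smulRight c) v = ⟪c, v⟫ • b - ⟪b, v⟫ • c := by
  simp [ContinuousLinearMap.smulRight_apply, innerSL_apply_apply]

/-- The rotation generator `A v = ⟪c, v⟫ b − ⟪b, v⟫ c` is skew: `⟪A v, v⟫ = 0` for every `v`
(`⟪c, v⟫⟪b, v⟫ − ⟪b, v⟫⟪c, v⟫ = 0`). [folklore] -/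
theorem inner_rotationGenerator_self (b c v : E) :
    ⟪((innerSL ℝ c).smulRight b - (innerSL ℝ b).smulRight c) v, v⟫ = 0 := by
  rw [rotationGenerator_apply, inner_sub_left, real_inner_smul_left, real_inner_smul_left]
  ring

/-- **Infinitesimal rotation invariance (stub `Z3` of line Sketch, skeleton v16).** Let
`F : (ℝ³)ⁿ → ℝ` be invariant under the diagonal action of every linear isometric isomorphism of
`ℝ³`, `F ((R yᵢ)ᵢ) = F y`, and differentiable at the configuration `x`. Then the derivative of
`F` at `x` along every rotation generator vanishes: for all `b c : ℝ³`,
`DF(x)[(⟪c, xᵢ⟫ b − ⟪b, xᵢ⟫ c)ᵢ] = 0`. Proof: with the skew generator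
`A v = ⟪c, v⟫ b − ⟪b, v⟫ c`, the curve `t ↦ (e^{tA} xᵢ)ᵢ` consists of diagonal images of `x`
under the linear isometric isomorphisms `e^{tA}` (`exists_linearIsometryEquiv_eq_exp_smul`), so
`F` is constant along it, while the chain rule computes its derivative at `t = 0` as
`DF(x)[(A xᵢ)ᵢ]`; derivatives are unique. [folklore] -/
theorem stub_fderiv_rotationGenerator : ∀ (n : ℕ) (F : (Fin n → EuclideanSpace ℝ (Fin 3)) → ℝ)
    (x : Fin n → EuclideanSpace ℝ (Fin 3)), DifferentiableAt ℝ F x →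
    (∀ (R : EuclideanSpace ℝ (Fin 3) ≃ₗᵢ[ℝ] EuclideanSpace ℝ (Fin 3)) (y : Fin n → EuclideanSpace ℝ (Fin 3)),
      F (fun i => R (y i)) = F y) →
    ∀ b c : EuclideanSpace ℝ (Fin 3), fderiv ℝ F x (fun i => inner ℝ c (x i) • b - inner ℝ b (x i) • c) = 0 := by
  intro n F x hF hR b c
  -- the generator `A v = ⟪c, v⟫ b - ⟪b, v⟫ c`, as an (opaque) bounded operator
  obtain ⟨A, hA⟩ : ∃ A : EuclideanSpace ℝ (Fin 3) →L[ℝ] EuclideanSpace ℝ (Fin 3),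
      A = (innerSL ℝ c).smulRight b - (innerSL ℝ b).smulRight c := ⟨_, rfl⟩
  have hAv : ∀ v, A v = ⟪c, v⟫ • b - ⟪b, v⟫ • c := fun v => by
    rw [hA]
    exact rotationGenerator_apply b c v
  have hskew : ∀ v, ⟪A v, v⟫ = 0 := fun v => by
    rw [hA]
    exact inner_rotationGenerator_self b c v
  -- the rotation curve `γ t = (e^{tA} xᵢ)ᵢ` through `γ 0 = x`, with `γ' 0 = (A xᵢ)ᵢ`
  have hγ : HasDerivAt (fun t : ℝ => fun i => NormedSpace.exp (t • A) (x i))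
      (fun i => A (x i)) 0 := by
    rw [hasDerivAt_pi]
    intro i
    exact hasDerivAt_exp_smul_clm_apply_zero A (x i)
  have hγ0 : x = (fun i => NormedSpace.exp ((0 : ℝ) • A) (x i)) := by
    funext i
    exact (exp_zero_smul_clm_apply A (x i)).symm
  -- chain rule: `d/dt|₀ F (γ t) = DF(x)[(A xᵢ)ᵢ]`
  have hcomp : HasDerivAt (F ∘ fun t : ℝ => fun i => NormedSpace.exp (t • A) (x i))
      (fderiv ℝ F x (fun i => A (x i))) 0 :=
    hF.hasFDerivAt.comp_hasDerivAt_of_eq (0 : ℝ) hγ hγ0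
  -- rotation invariance: `F ∘ γ` is the constant `F x`
  have hconst : (F ∘ fun t : ℝ => fun i => NormedSpace.exp (t • A) (x i)) = fun _ => F x := by
    funext t
    obtain ⟨L, hL⟩ := exists_linearIsometryEquiv_eq_exp_smul hskew t
    have h := hR L x
    simp only [hL] at h
    exact h
  rw [hconst] at hcomp
  have h0 : fderiv ℝ F x (fun i => A (x i)) = 0 := hcomp.unique (hasDerivAt_const (0 : ℝ) (F x))
  have hfun : (fun i => inner ℝ c (x i) • b - inner ℝ b (x i) • c) = fun i => A (x i) := by
    funext i
    exact (hAv (x i)).symm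
  rw [hfun]
  exact h0

end Summit.CriticalPhenomena.Ising3DConformalLimit.MoebiusLimitExistsSketchV16
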